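import Mathlib
import Literature.MathematicalPhysics.StatisticalMechanics.Crystallization
import Literature.MathematicalPhysics.StatisticalMechanics.LennardJonesClusters
import Literature.MathematicalPhysics.StatisticalMechanics.OneCrossingMixture
import Summits.AtomisticToContinuum.Crystallization.Theses.ReggeStarCoercivity

/-!
# Route `ReggeStarCoercivity`, crux stmt-AtomisticToContinuum-13601 `StabilityConstantTwelve`
# — line `Sketch` (two-point minorant with a one-crossing Gaussian-subordination certificate)

SKELETON (lead prover).  Composition `StabilityConstantTwelve_of`:

* `stub_reduction` — Fisher–Ruelle / Cohn–Kumar zero-pressure reduction: a function `g` of the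
  squared distance with `Σ_{i,j} g(|x_i - x_j|²) ≥ 0` for every finite configuration,
  `g(r²) ≤ V_LJ(r)` for `r > 0` and `g(0) ≤ 2` gives `𝓔_N(x) ≥ -N` on distinct points.
* `stub_gaussSum_mono` — `t ↦ t^{3/2} Σ_{i,j} e^{-t|x_i-x_j|²}` is non-decreasing on `(0,∞)`
  (Gaussian Fourier representation on `ℝ³`, Mathlib `GaussianFourier.integral_cexp_neg_mul_sq_norm_add`).
* `stub_engine` — one-crossing Gaussian subordination: if `a ≤ 0` on `(0,t₀)`, `a ≥ 0` on `[t₀,∞)`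
  and `∫ a(t) t^{-3/2} ≥ 0`, then `Σ_{i,j} ∫ e^{-t|x_i-x_j|²} a(t) dt ≥ 0` (Chebyshev rearrangement
  against the monotone `t^{3/2} Σ e^{-t d²}`).
* `stub_cert_analytic` — for the polynomial-times-exponential densities
  `a(t) = e^{-σt} Σ_q b_q σ^{q+2} t^{q+1}/(q+1)!`: integrability, the `t^{-3/2}`-mass in closed
  form (`Γ(q+1/2) = (2q-1)‼ √π / 2^q`), and the Gaussian-mixture closed form
  `∫_0^∞ e^{-tu} a(t) dt = Σ_q b_q (σ/(σ+u))^{q+2}` (Euler's integral).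
* `stub_cert_crossing` — Descartes: one sign change in `(b_q)` gives one crossing of `a`.
* `stub_cert_numeric` — the explicit rational certificate (LP in the one-crossing cone):
  coefficients with one sign change, non-negative mass, `Σ_q b_q (σ/(σ+r²))^{q+2} ≤ V_LJ(r)` for
  `r > 0`, and `Σ_q b_q ≤ 2`.
-/

noncomputable section

namespace Summit.AtomisticToContinuum.Crystallization.Theorems

open MeasureTheory Set Real
open scoped Nat
open Literature.MathematicalPhysics.StatisticalMechanics

/-- STUB S1 (reduction). Fisher–Ruelle / Cohn–Kumar Prop. 9.3 at zero pressure, finite form: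
a positive-definite-in-sum minorant of `V_LJ` with `g 0 ≤ 2` gives `𝓔_N(x) ≥ -N` for every
configuration of `N` distinct points. -/
theorem stub_reduction (g : ℝ → ℝ)
    (hpd : ∀ (N : ℕ) (x : Fin N → EuclideanSpace ℝ (Fin 3)), 0 ≤ ∑ i, ∑ j, g (‖x i - x j‖ ^ 2))
    (hle : ∀ r : ℝ, 0 < r → g (r ^ 2) ≤ lennardJones r) (hg0 : g 0 ≤ 2)
    (N : ℕ) (x : Fin N → EuclideanSpace ℝ (Fin 3)) (hx : Function.Injective x) :
    -(N : ℝ) ≤ interactionEnergy lennardJones x := by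
  sorry

/-- STUB S3b (Gaussian monotonicity). For every finite configuration in `ℝ³`,
`t ↦ t^{3/2} Σ_{i,j} e^{-t |x_i - x_j|²}` is non-decreasing on `(0, ∞)`:
`t^{3/2} e^{-t|w|²} = π^{3/2} ∫ e^{-π²|v|²/t} e^{2πi⟨w,v⟩} dv` and
`Σ_{i,j} e^{2πi⟨x_i - x_j, v⟩} = |Σ_i e^{2πi⟨x_i,v⟩}|² ≥ 0`. -/
theorem stub_gaussSum_mono (N : ℕ) (x : Fin N → EuclideanSpace ℝ (Fin 3)) {t₁ t₂ : ℝ}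
    (ht₁ : 0 < t₁) (h : t₁ ≤ t₂) :
    t₁ ^ ((3 : ℝ) / 2) * ∑ i, ∑ j, Real.exp (-(t₁ * ‖x i - x j‖ ^ 2)) ≤
      t₂ ^ ((3 : ℝ) / 2) * ∑ i, ∑ j, Real.exp (-(t₂ * ‖x i - x j‖ ^ 2)) := by
  sorry

/-- STUB S3a (one-crossing engine). If the density `a` is `≤ 0` on `(0,t₀)`, `≥ 0` on `[t₀,∞)`,
integrable, with `∫_0^∞ a(t) t^{-3/2} dt ≥ 0`, and `t^{3/2} Σ_{i,j} e^{-t|x_i-x_j|²}` is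
non-decreasing in `t`, then `Σ_{i,j} ∫_0^∞ e^{-t|x_i-x_j|²} a(t) dt ≥ 0`. -/
theorem stub_engine (a : ℝ → ℝ) (t₀ : ℝ) (ht₀ : 0 < t₀)
    (hneg : ∀ t ∈ Set.Ioo 0 t₀, a t ≤ 0) (hpos : ∀ t, t₀ ≤ t → 0 ≤ a t)
    (ha : IntegrableOn a (Ioi 0))
    (ha' : IntegrableOn (fun t => a t * t ^ (-(3 / 2 : ℝ))) (Ioi 0))
    (hmass : 0 ≤ ∫ t in Ioi 0, a t * t ^ (-(3 / 2 : ℝ)))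
    (hmono : ∀ (N : ℕ) (x : Fin N → EuclideanSpace ℝ (Fin 3)) (t₁ t₂ : ℝ), 0 < t₁ → t₁ ≤ t₂ →
      t₁ ^ ((3 : ℝ) / 2) * ∑ i, ∑ j, Real.exp (-(t₁ * ‖x i - x j‖ ^ 2)) ≤
        t₂ ^ ((3 : ℝ) / 2) * ∑ i, ∑ j, Real.exp (-(t₂ * ‖x i - x j‖ ^ 2)))
    (N : ℕ) (x : Fin N → EuclideanSpace ℝ (Fin 3)) :
    0 ≤ ∑ i, ∑ j, ∫ t in Ioi 0, Real.exp (-(t * ‖x i - x j‖ ^ 2)) * a t := by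
  sorry

/-- STUB S4a (analytic facts of the certificate family). For `σ > 0` and coefficients `b_q`,
the density `a(t) = e^{-σt} Σ_{q<K} b_q σ^{q+2} t^{q+1}/(q+1)!` is integrable on `(0,∞)`, so is
`a(t) t^{-3/2}`, its `t^{-3/2}`-mass is `σ^{3/2} √π Σ_q b_q (2q-1)‼ / (2^q (q+1)!)`
(`∫_0^∞ t^{q-1/2} e^{-σt} dt = Γ(q+1/2) σ^{-(q+1/2)}`, `Real.Gamma_nat_add_half`), and its Gaussian
mixture is `∫_0^∞ e^{-tu} a(t) dt = Σ_q b_q (σ/(σ+u))^{q+2}` for `u ≥ 0` (Euler's integral,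
`integral_exp_neg_mul_mul_pow`). -/
theorem stub_cert_analytic (σ : ℝ) (hσ : 0 < σ) (K : ℕ) (b : ℕ → ℝ) (a : ℝ → ℝ)
    (ha : a = fun t => Real.exp (-(σ * t)) *
      ∑ q ∈ Finset.range K, b q * σ ^ (q + 2) * t ^ (q + 1) / ((q + 1)! : ℝ)) :
    IntegrableOn a (Ioi 0) ∧
    IntegrableOn (fun t => a t * t ^ (-(3 / 2 : ℝ))) (Ioi 0) ∧
    (∫ t in Ioi 0, a t * t ^ (-(3 / 2 : ℝ))) =
      σ ^ ((3 : ℝ) / 2) * √π * ∑ q ∈ Finset.range K, b q * ((2 * q - 1)‼ : ℝ) / (2 ^ q * (q + 1)! : ℝ) ∧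
    ∀ u : ℝ, 0 ≤ u →
      (∫ t in Ioi 0, Real.exp (-(t * u)) * a t) = ∑ q ∈ Finset.range K, b q * (σ / (σ + u)) ^ (q + 2) := by
  sorry

/-- STUB S4b (Descartes, one sign change ⇒ one crossing). If `b_q ≤ 0` for `q < k`, `b_q ≥ 0`
for `q ≥ k`, some `b_q < 0` below `k` and some `b_q > 0` at or above `k` (and below `K`), then
`a(t) = e^{-σt} Σ_{q<K} b_q σ^{q+2} t^{q+1}/(q+1)!` is `≤ 0` on `(0,t₀)` and `≥ 0` on `[t₀,∞)` for
some `t₀ > 0` (`t^{-(k+1)} e^{σt} a(t)` is strictly increasing). -/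
theorem stub_cert_crossing (σ : ℝ) (hσ : 0 < σ) (K k : ℕ) (b : ℕ → ℝ)
    (hneg : ∀ q, q < k → b q ≤ 0) (hpos : ∀ q, k ≤ q → 0 ≤ b q)
    (hex_neg : ∃ q, q < k ∧ b q < 0) (hex_pos : ∃ q, k ≤ q ∧ q < K ∧ 0 < b q)
    (a : ℝ → ℝ)
    (ha : a = fun t => Real.exp (-(σ * t)) *
      ∑ q ∈ Finset.range K, b q * σ ^ (q + 2) * t ^ (q + 1) / ((q + 1)! : ℝ)) :
    ∃ t₀ : ℝ, 0 < t₀ ∧ (∀ t ∈ Set.Ioo 0 t₀, a t ≤ 0) ∧ (∀ t, t₀ ≤ t → 0 ≤ a t) := by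
  sorry

/-- STUB S5 (Hermite dipole piece is positive definite in sum). For `t₀ > 0`, `c₁ ≤ 0` and
`t₀ uₛ ≥ 3/2`, the radial function `h(u) = c₁ (u - uₛ) e^{-t₀ u}` of the squared distance satisfies
`Σ_{i,j} h(|x_i - x_j|²) ≥ 0` for every finite configuration in `ℝ³`: with
`S(t) = Σ_{i,j} e^{-t|x_i-x_j|²}` the sum is `(-c₁) (S'(t₀) + uₛ S(t₀))`, and since `t ↦ t^{3/2} S(t)`
is non-decreasing (`stub_gaussSum_mono`), `S'(t₀) ≥ -(3/(2t₀)) S(t₀)`. -/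
theorem stub_hermite_pd (t₀ uₛ c₁ : ℝ) (ht₀ : 0 < t₀) (hc₁ : c₁ ≤ 0) (hpd : 3 / 2 ≤ t₀ * uₛ)
    (N : ℕ) (x : Fin N → EuclideanSpace ℝ (Fin 3)) :
    0 ≤ ∑ i, ∑ j, c₁ * (‖x i - x j‖ ^ 2 - uₛ) * Real.exp (-(t₀ * ‖x i - x j‖ ^ 2)) := by
  sorry

/-- STUB S4c (the explicit certificate; numeric, held by the lead). Rational data of the hybrid
certificate `g(u) = c₁ (u - uₛ) e^{-t₀u} + Σ_{q<K} b_q (σ/(σ+u))^{q+2}`: the sign / mass conditions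
that make both pieces positive definite in sum, the three REGION forms of the minorant inequality
`g(r²) ≤ V_LJ(r)` in which `e^{-t₀u}` is replaced by its Taylor envelopes
(`1/Σ_{k≤m} xᵏ/k!` from above on `(0, uₛ]`, `1/(Σ_{k<n} xᵏ/k! + 2xⁿ/n!)` from below on `[uₛ, u₁]`,
and `0` on `[u₁, ∞)`; `x = t₀ u`, envelope valid for `2 t₀ u₁ ≤ n + 1`) — three univariate
rational inequalities — and the value `-c₁ uₛ + Σ_q b_q ≤ 2`. -/
theorem stub_cert_numeric :
    ∃ (t₀ uₛ u₁ c₁ σ : ℝ) (m n K k : ℕ) (b : ℕ → ℝ),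
      0 < t₀ ∧ c₁ ≤ 0 ∧ 3 / 2 ≤ t₀ * uₛ ∧ 0 < uₛ ∧ uₛ ≤ u₁ ∧ 2 * (t₀ * u₁) ≤ n + 1 ∧ 0 < σ ∧
      (∀ q, q < k → b q ≤ 0) ∧ (∀ q, k ≤ q → 0 ≤ b q) ∧
      (∃ q, q < k ∧ b q < 0) ∧ (∃ q, k ≤ q ∧ q < K ∧ 0 < b q) ∧
      0 ≤ ∑ q ∈ Finset.range K, b q * ((2 * q - 1)‼ : ℝ) / (2 ^ q * (q + 1)! : ℝ) ∧
      (∀ r : ℝ, 0 < r → r ^ 2 ≤ uₛ →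
        c₁ * (r ^ 2 - uₛ) / (∑ i ∈ Finset.range (m + 1), (t₀ * r ^ 2) ^ i / (i ! : ℝ)) +
          (∑ q ∈ Finset.range K, b q * (σ / (σ + r ^ 2)) ^ (q + 2)) ≤ lennardJones r) ∧
      (∀ r : ℝ, 0 < r → uₛ ≤ r ^ 2 → r ^ 2 ≤ u₁ →
        c₁ * (r ^ 2 - uₛ) /
            (∑ i ∈ Finset.range n, (t₀ * r ^ 2) ^ i / (i ! : ℝ) + (t₀ * r ^ 2) ^ n / (n ! : ℝ) * 2) +
          (∑ q ∈ Finset.range K, b q * (σ / (σ + r ^ 2)) ^ (q + 2)) ≤ lennardJones r) ∧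
      (∀ r : ℝ, 0 < r → u₁ ≤ r ^ 2 →
        (∑ q ∈ Finset.range K, b q * (σ / (σ + r ^ 2)) ^ (q + 2)) ≤ lennardJones r) ∧
      -(c₁ * uₛ) + (∑ q ∈ Finset.range K, b q) ≤ 2 := by
  sorry

/-- Taylor envelope from above for `e^{-x}`, `x ≥ 0`: `e^{-x} ≤ 1 / Σ_{i≤m} xⁱ/i!`
(`Real.sum_le_exp_of_nonneg`). -/
theorem exp_neg_le_inv_taylor {x : ℝ} (hx : 0 ≤ x) (m : ℕ) :
    Real.exp (-x) ≤ 1 / ∑ i ∈ Finset.range (m + 1), x ^ i / (i ! : ℝ) := by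
  have hT : ∑ i ∈ Finset.range (m + 1), x ^ i / (i ! : ℝ) ≤ Real.exp x :=
    Real.sum_le_exp_of_nonneg hx (m + 1)
  have hpos : 0 < ∑ i ∈ Finset.range (m + 1), x ^ i / (i ! : ℝ) := by
    rw [Finset.sum_range_succ']
    have : 0 ≤ ∑ i ∈ Finset.range m, x ^ (i + 1) / ((i + 1)! : ℝ) :=
      Finset.sum_nonneg fun i _ => by positivity
    simpa using by positivity
  rw [Real.exp_neg, inv_eq_one_div]
  exact one_div_le_one_div_of_le hpos hT

/-- Taylor envelope from above for `e^{x}`, `0 ≤ x ≤ (n+1)/2`: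
`e^{x} ≤ Σ_{i<n} xⁱ/i! + 2 xⁿ/n!` (real form of `Complex.exp_bound'`). -/
theorem exp_le_taylor_add {x : ℝ} (hx : 0 ≤ x) {n : ℕ} (hxn : 2 * x ≤ n + 1) :
    Real.exp x ≤ ∑ i ∈ Finset.range n, x ^ i / (i ! : ℝ) + x ^ n / (n ! : ℝ) * 2 := by
  have hx' : ‖(x : ℂ)‖ / (n.succ : ℕ) ≤ 1 / 2 := by
    rw [Complex.norm_real, Real.norm_eq_abs, abs_of_nonneg hx, Nat.cast_succ,
      div_le_div_iff₀ (by positivity) (by norm_num)]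
    linarith
  have h := Complex.exp_bound' hx'
  have hre : (Complex.exp x - ∑ m ∈ Finset.range n, (x : ℂ) ^ m / (m.factorial : ℂ)).re =
      Real.exp x - ∑ i ∈ Finset.range n, x ^ i / (i ! : ℝ) := by
    rw [Complex.sub_re, ← Complex.ofReal_exp, Complex.ofReal_re, Complex.re_sum]
    congr 1
    refine Finset.sum_congr rfl fun i _ => ?_
    rw [← Complex.ofReal_pow, ← Complex.ofReal_natCast, ← Complex.ofReal_div, Complex.ofReal_re]
  have h1 : Real.exp x - ∑ i ∈ Finset.range n, x ^ i / (i ! : ℝ) ≤ ‖(x : ℂ)‖ ^ n / (n ! : ℝ) * 2 := by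
    rw [← hre]; exact (Complex.re_le_norm _).trans h
  rw [Complex.norm_real, Real.norm_eq_abs, abs_of_nonneg hx] at h1
  linarith

/-- COMPOSITION: the stubs close the crux `StabilityConstantTwelve` (`E(N) ≥ -N` for the
Lennard-Jones ground-state energy in `ℝ³`, Blanc–Lewin units). -/
theorem StabilityConstantTwelve_of :
    Summit.AtomisticToContinuum.Crystallization.Theses.ReggeStarCoercivity.StabilityConstantTwelve := by
  obtain ⟨t₀, uₛ, u₁, c₁, σ, m, n, K, k, b, ht₀, hc₁, hpd0, huₛ, hu₁, hn, hσ, hneg, hpos, hex_neg,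
    hex_pos, hmass, hA, hB, hC, hval⟩ := stub_cert_numeric
  -- the rational piece: density and Gaussian mixture
  set a : ℝ → ℝ := fun t => Real.exp (-(σ * t)) *
      ∑ q ∈ Finset.range K, b q * σ ^ (q + 2) * t ^ (q + 1) / ((q + 1)! : ℝ) with ha_def
  set R : ℝ → ℝ := fun u => ∑ q ∈ Finset.range K, b q * (σ / (σ + u)) ^ (q + 2) with hR_def
  -- the Hermite piece and the full certificate
  set h : ℝ → ℝ := fun u => c₁ * (u - uₛ) * Real.exp (-(t₀ * u)) with hh_def
  set g : ℝ → ℝ := fun u => h u + R u with hg_def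
  obtain ⟨ha_int, ha_int', ha_mass, ha_repr⟩ := stub_cert_analytic σ hσ K b a ha_def
  obtain ⟨t₁, ht₁, ha_neg, ha_pos⟩ := stub_cert_crossing σ hσ K k b hneg hpos hex_neg hex_pos a ha_def
  have hmass' : 0 ≤ ∫ t in Ioi 0, a t * t ^ (-(3 / 2 : ℝ)) := by
    rw [ha_mass]
    have h1 : 0 ≤ σ ^ ((3 : ℝ) / 2) := by positivity
    have h2 : 0 ≤ √π := Real.sqrt_nonneg _
    exact mul_nonneg (mul_nonneg h1 h2) hmass
  -- positive definiteness in sum of both pieces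
  have hpdR : ∀ (N : ℕ) (x : Fin N → EuclideanSpace ℝ (Fin 3)),
      0 ≤ ∑ i, ∑ j, R (‖x i - x j‖ ^ 2) := by
    intro N x
    have hrw : ∀ i j : Fin N, R (‖x i - x j‖ ^ 2) =
        ∫ t in Ioi 0, Real.exp (-(t * ‖x i - x j‖ ^ 2)) * a t := fun i j =>
      (ha_repr _ (sq_nonneg _)).symm
    simp_rw [hrw]
    exact stub_engine a t₁ ht₁ ha_neg ha_pos ha_int ha_int' hmass'
      (fun N x t₁ t₂ h₁ h₁₂ => stub_gaussSum_mono N x h₁ h₁₂) N x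
  have hpd : ∀ (N : ℕ) (x : Fin N → EuclideanSpace ℝ (Fin 3)),
      0 ≤ ∑ i, ∑ j, g (‖x i - x j‖ ^ 2) := by
    intro N x
    have hsplit : ∑ i, ∑ j, g (‖x i - x j‖ ^ 2) =
        (∑ i, ∑ j, c₁ * (‖x i - x j‖ ^ 2 - uₛ) * Real.exp (-(t₀ * ‖x i - x j‖ ^ 2))) +
          ∑ i, ∑ j, R (‖x i - x j‖ ^ 2) := by
      rw [← Finset.sum_add_distrib]
      refine Finset.sum_congr rfl fun i _ => ?_
      rw [← Finset.sum_add_distrib]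
    rw [hsplit]
    exact add_nonneg (stub_hermite_pd t₀ uₛ c₁ ht₀ hc₁ hpd0 N x) (hpdR N x)
  -- the minorant inequality, by regions
  have hle : ∀ r : ℝ, 0 < r → g (r ^ 2) ≤ lennardJones r := by
    intro r hr
    have hx0 : 0 ≤ t₀ * r ^ 2 := by positivity
    show h (r ^ 2) + R (r ^ 2) ≤ lennardJones r
    rcases le_or_gt (r ^ 2) uₛ with hAu | hBu
    · -- region A: `c₁ (u - uₛ) ≥ 0`, envelope from above
      have hfac : 0 ≤ c₁ * (r ^ 2 - uₛ) := mul_nonneg_of_nonpos_of_nonpos hc₁ (by linarith)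
      have hT : 0 < ∑ i ∈ Finset.range (m + 1), (t₀ * r ^ 2) ^ i / (i ! : ℝ) := by
        rw [Finset.sum_range_succ']
        have : 0 ≤ ∑ i ∈ Finset.range m, (t₀ * r ^ 2) ^ (i + 1) / ((i + 1)! : ℝ) :=
          Finset.sum_nonneg fun i _ => by positivity
        simpa using by positivity
      have henv := exp_neg_le_inv_taylor hx0 m
      have hh : h (r ^ 2) ≤ c₁ * (r ^ 2 - uₛ) / ∑ i ∈ Finset.range (m + 1), (t₀ * r ^ 2) ^ i / (i ! : ℝ) := by
        show c₁ * (r ^ 2 - uₛ) * Real.exp (-(t₀ * r ^ 2)) ≤ _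
        rw [div_eq_mul_one_div]
        exact mul_le_mul_of_nonneg_left henv hfac
      linarith [hA r hr hAu]
    rcases le_or_gt (r ^ 2) u₁ with hBu' | hCu
    · -- region B: `c₁ (u - uₛ) ≤ 0`, envelope from below
      have hfac : c₁ * (r ^ 2 - uₛ) ≤ 0 := mul_nonpos_of_nonpos_of_nonneg hc₁ (by linarith)
      have hxn : 2 * (t₀ * r ^ 2) ≤ n + 1 := by nlinarith
      have hup := exp_le_taylor_add hx0 hxn
      set T := ∑ i ∈ Finset.range n, (t₀ * r ^ 2) ^ i / (i ! : ℝ) + (t₀ * r ^ 2) ^ n / (n ! : ℝ) * 2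
        with hT_def
      have hTpos : 0 < T := (Real.exp_pos _).trans_le hup
      have henv : 1 / T ≤ Real.exp (-(t₀ * r ^ 2)) := by
        rw [Real.exp_neg, ← one_div]
        exact one_div_le_one_div_of_le (Real.exp_pos _) hup
      have hh : h (r ^ 2) ≤ c₁ * (r ^ 2 - uₛ) / T := by
        show c₁ * (r ^ 2 - uₛ) * Real.exp (-(t₀ * r ^ 2)) ≤ _
        rw [div_eq_mul_one_div]
        exact mul_le_mul_of_nonpos_left henv hfac
      linarith [hB r hr hBu.le hBu']
    · -- region C: `h ≤ 0`
      have hh : h (r ^ 2) ≤ 0 := by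
        show c₁ * (r ^ 2 - uₛ) * Real.exp (-(t₀ * r ^ 2)) ≤ 0
        exact mul_nonpos_of_nonpos_of_nonneg
          (mul_nonpos_of_nonpos_of_nonneg hc₁ (by linarith)) (Real.exp_pos _).le
      linarith [hC r hr hCu.le]
  have hg0 : g 0 ≤ 2 := by
    have hR0 : R 0 = ∑ q ∈ Finset.range K, b q := by
      rw [hR_def]
      refine Finset.sum_congr rfl fun q _ => ?_
      rw [add_zero, div_self hσ.ne', one_pow, mul_one]
    have hh0 : h 0 = -(c₁ * uₛ) := by
      show c₁ * (0 - uₛ) * Real.exp (-(t₀ * 0)) = -(c₁ * uₛ)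
      rw [mul_zero, neg_zero, Real.exp_zero]; ring
    show h 0 + R 0 ≤ 2
    rw [hh0, hR0]; exact hval
  -- reduction and the infimum over distinct configurations
  unfold Summit.AtomisticToContinuum.Crystallization.Theses.ReggeStarCoercivity.StabilityConstantTwelve
  intro N
  haveI := nonempty_injective_config (d := 3) (by norm_num) N
  exact le_ciInf fun y => stub_reduction g hpd hle hg0 N y.1 y.2

end Summit.AtomisticToContinuum.Crystallization.Theorems
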